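import Summits.BirchSwinnertonDyer.BirchSwinnertonDyer.Theorems.SchneiderFreeAdditiveX3PoitouTateMuKummerUnramified
import HarnessLib

/-!
# Poitou–Tate toolkit (μₙ-case at EVERY level, 2/·): Kummer classes of local units are unramified away
# from `n`, for an arbitrary level `n`

Cell `bsd-schneider-ideate`, seat `bsd-schneider-door-c6` (prover, generation 7).  PARTITION: board row
B6 ∩ X3 ∩ sst-twist, `r = 1` — CONTROL corner (crux `AnticycControlAdditiveK`, stmt-BirchSwinnertonDyer-19295).
THEOREMS ONLY.  HONEST FRAMING: tools (no case of Poitou–Tate by itself, no case of BSD).  Door-c6 g6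
(`…PoitouTateMuMiddleExact`, `…PoitouTateMuKummerUnramified`) proved these three lemmas at a PRIME level
`p`; their proofs use primality nowhere (the Kummer-unit lemma `smul_root_eq_of_mem_inertia_of_pow_eq` is
stated for any `d ≥ 1`, the local Kummer dictionary `KummerClassLocalSurjective` for any `n ≥ 1`), and the
level-`n` assembly of Milne I Thm. 4.10(b) for `μₙ` (file 3/·) needs them at every `n`:

* `localization_kummer_eq_of_eq_mul_pow` — two elements of `Kˣ` congruent modulo `(K_vˣ)ⁿ` have the same
  local Kummer class at level `n`;
* `localization_kummer_mem_unramifiedSubgroup_of_not_mem` — for `a ∈ 𝓞_K` with `a ∉ w`, `n ∉ w`, the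
  localisation at `w` of `κₙ(a)` lies in `unramifiedSubgroup`;
* `localization_kummer_mem_unramifiedSubgroup_of_eq_unit_mul_pow` — the same for `a ∈ Kˣ` lying in
  `𝒪_wˣ · (K_wˣ)ⁿ` (density of `𝓞_K` in `𝒪_w`).

References: [MilneADT2006] I §2; [Neukirch2013] Part III Thm. (7.7) (proof); [SilvermanAEC2009] Prop. VIII.1.6;
[SerreLocalFields1979] X §3, XIV §1.
-/

noncomputable section

open CategoryTheory Function NumberField IsDedekindDomain Field ValuativeRel IntermediateField
open scoped NumberField Pointwise

set_option linter.dupNamespace false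
set_option autoImplicit false

namespace Summit.BirchSwinnertonDyer.BirchSwinnertonDyer.Theorems.SchneiderFreeAdditiveX3.PoitouTateReduction

open _root_.ContinuousCohomology
open Literature.NumberTheory.GaloisRepresentations
open Literature.NumberTheory.GaloisRepresentations.DiscreteGaloisModule
open Literature.NumberTheory.GaloisRepresentations.IsNonarchimedeanLocalField
open Literature.NumberTheory.GaloisCohomology
open Literature.NumberTheory.NumberFields
open Literature.AnabelianGeometry.AbsoluteAnabelian
open Literature.AnabelianGeometry.AbsoluteAnabelian.Prop121vii
open Summit.BirchSwinnertonDyer.Rank1Residual.X11b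

variable {K : Type} [Field K] [NumberField K] {n : ℕ} [NeZero n]

/-- **Two elements of `Kˣ` congruent modulo `(K_vˣ)ⁿ` have the same local Kummer class at level `n`**
(`loc_v κₙ(a) = loc_v κₙ(b)` when `b = a · cⁿ` in `K_v`); door-c6 g6's `localization_δ₀_eq_of_eq_mul_pow` at
an arbitrary level. [cite: SerreLocalFields1979, X §3] -/
theorem localization_kummer_eq_of_eq_mul_pow (v : HeightOneSpectrum (𝓞 K)) (a b : K) (ha : a ≠ 0) (hb : b ≠ 0)
    {c : v.adicCompletion K} (hc : c ≠ 0)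
    (h : algebraMap K (v.adicCompletion K) b = algebraMap K (v.adicCompletion K) a * c ^ n) :
    galoisCohomology.localization (mu K n) (Sum.inr v) 1
        ((isSES_kummer K n (NeZero.pos n)).δ₀ (baseUnitsInvariant K b hb)) =
      galoisCohomology.localization (mu K n) (Sum.inr v) 1
        ((isSES_kummer K n (NeZero.pos n)).δ₀ (baseUnitsInvariant K a ha)) := by
  obtain ⟨x, hx, hxt⟩ := exists_cohomologyMap_muLocalIso_eq_δ₀ v
    (galoisCohomology.localization (mu K n) (Sum.inr v) 1
      ((isSES_kummer K n (NeZero.pos n)).δ₀ (baseUnitsInvariant K a ha)))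
  -- `x ≡ a (mod n-th powers)`: indeed the transported class of `a` is `κ(a_v)`
  have ha' : algebraMap K (v.adicCompletion K) a ≠ 0 := (map_ne_zero_iff _ (algebraMap K _).injective).2 ha
  have hkey : (cohomologyMap (muLocalIso v n).hom 1).hom
      (galoisCohomology.localization (mu K n) (Sum.inr v) 1
        ((isSES_kummer K n (NeZero.pos n)).δ₀ (baseUnitsInvariant K a ha))) =
      (isSES_kummer (v.adicCompletion K) n (NeZero.pos n)).δ₀
        (baseUnitsInvariant (v.adicCompletion K) (algebraMap K (v.adicCompletion K) a) ha') := by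
    rw [cohomologyMap_muLocalIso_localization, resMu_δ₀_baseUnitsInvariant K (v.adicCompletion K) a ha ha']
  exact localization_δ₀_baseUnitsInvariant_eq_of_eq_mul_pow v _ ha' hkey b hb hc h

/-- **For `a ∈ 𝓞_K` with `a ∉ w` and `n ∉ w`, `loc_w κₙ(a) ∈ H¹_ur(K_w, μₙ)`** (any level `n ≥ 1`): the
Kummer cocycle `σ ↦ σβ/β` (`βⁿ = a`) vanishes on the inertia group of `Γ_{K_w}`, which restricts into the
inertia group `I_𝔓₀ ≤ Γ_K` of the prime `𝔓₀` of `\bar ℤ_K` cut out by `K̄ → K̄_w`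
(`inertia_adicCompletionPrime_eq_map_absInertia`), and `I_𝔓₀` fixes `β`
(`absoluteGaloisGroup_smul_root_eq_of_mem_inertia_of_pow_eq`, any `d ≥ 1`).
[cite: MilneADT2006, Ch. I §2 (unramified cohomology)] [cite: Neukirch2013, Part III Thm. (7.7) (proof, p. 176)] -/
theorem localization_kummer_mem_unramifiedSubgroup_of_not_mem (w : HeightOneSpectrum (𝓞 K)) (a : 𝓞 K)
    (haw : a ∉ w.asIdeal) (hnw : ((n : ℕ) : 𝓞 K) ∉ w.asIdeal) (ha : (a : K) ≠ 0) :
    galoisCohomology.localization (mu K n) (Sum.inr w) 1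
        ((isSES_kummer K n (NeZero.pos n)).δ₀ (baseUnitsInvariant K (a : K) ha)) ∈
      unramifiedSubgroup (GaloisRep.toLocal w (mu K n)) 1 := by
  set h := isSES_kummer K n (NeZero.pos n)
  set u := baseUnitsInvariant K (a : K) ha with hu
  -- an `n`-th root `β` of `a` in `K̄ˣ`
  obtain ⟨β, hβ⟩ := h.surjective (u : UnitsCarrier K)
  have hβp : (unitsVal K β : AlgebraicClosure K) ^ n = algebraMap (𝓞 K) (AlgebraicClosure K) a := by
    have e := congrArg (unitsVal K) hβ
    rw [kummerπ_hom_apply, unitsVal_zsmul, zpow_natCast] at e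
    have e' := congrArg (fun z : (AlgebraicClosure K)ˣ => (z : AlgebraicClosure K)) e
    simp only [Units.val_pow_eq_pow_val] at e'
    rw [e', hu, coe_unitsVal_baseUnitsInvariant, IsScalarTower.algebraMap_apply (𝓞 K) K (AlgebraicClosure K)]
  rw [h.δ₀_apply_eq u β hβ]
  change galoisCohomology.res (mu K n) (w.adicCompletion K) 1 (oneCocycleClass _ _) ∈
    unramifiedSubgroup (GaloisRep.toLocal w (mu K n)) 1
  rw [galoisCohomology.res_oneCocycleClass]
  refine (LocBridge.mem_unramifiedSubgroup_one_iff_exists (GaloisRep.toLocal w (mu K n)) _).mpr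
    ⟨0, fun τ hτ => ?_⟩
  rw [galoisCohomology.pullback_absGaloisRestrict_apply, map_zero, sub_zero]
  -- `res τ` lies in the inertia group of `𝔓₀` and fixes `β`
  have hmem : absGaloisRestrict K (w.adicCompletion K) τ ∈
      (adicCompletionPrime K w).inertia (absoluteGaloisGroup K) := by
    rw [inertia_adicCompletionPrime_eq_map_absInertia]
    exact ⟨τ, hτ, rfl⟩
  have hfix : absGaloisRestrict K (w.adicCompletion K) τ • (unitsVal K β : AlgebraicClosure K) =
      (unitsVal K β : AlgebraicClosure K) :=
    absoluteGaloisGroup_smul_root_eq_of_mem_inertia_of_pow_eq (NeZero.pos n) w haw hnw hβp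
      (adicCompletionPrime_mem_primesAbove K w) hmem
  have hfixβ : units K (absGaloisRestrict K (w.adicCompletion K) τ) β = β := by
    apply unitsVal_injective K
    rw [unitsVal_apply]
    exact Units.ext (by rw [Units.coe_smul]; exact hfix)
  apply h.injective
  rw [h.f_δ₀Cocycle_apply, map_zero]
  change units K (absGaloisRestrict K (w.adicCompletion K) τ) β - β = 0
  rw [hfixβ, sub_self]

/-- **For `a ∈ Kˣ` lying in `𝒪_wˣ · (K_wˣ)ⁿ`, `n ∉ w`: `loc_w κₙ(a) ∈ H¹_ur(K_w, μₙ)`** (any level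
`n ≥ 1`) — by density of `𝓞_K` in `𝒪_w` (`closureAlgebraMapIntegers_eq_integers`) and openness of
`(K_wˣ)ⁿ`, `a ≡ a'` modulo `(K_wˣ)ⁿ` for some `a' ∈ 𝓞_K` with `a' ∉ w`, and `loc_w κₙ(a) = loc_w κₙ(a')`.
[cite: MilneADT2006, Ch. I §2 (unramified cohomology)] [cite: SilvermanAEC2009, Prop. VIII.1.6 (proof)] -/
theorem localization_kummer_mem_unramifiedSubgroup_of_eq_unit_mul_pow (w : HeightOneSpectrum (𝓞 K)) (a : K)
    (ha : a ≠ 0) (hnw : ((n : ℕ) : 𝓞 K) ∉ w.asIdeal)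
    (hunit : ∃ (u : (w.adicCompletion K)ˣ) (c : w.adicCompletion K), Valued.v (u : w.adicCompletion K) = 1 ∧
      algebraMap K (w.adicCompletion K) a = u * c ^ n) :
    galoisCohomology.localization (mu K n) (Sum.inr w) 1
        ((isSES_kummer K n (NeZero.pos n)).δ₀ (baseUnitsInvariant K a ha)) ∈
      unramifiedSubgroup (GaloisRep.toLocal w (mu K n)) 1 := by
  classical
  set F := w.adicCompletion K with hF
  haveI : CharZero F := charZero_adicCompletion w
  obtain ⟨u, c, hu1, hac⟩ := hunit
  have hc0 : c ≠ 0 := by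
    rintro rfl
    rw [zero_pow (NeZero.ne n), mul_zero] at hac
    exact (map_ne_zero_iff _ (algebraMap K F).injective).2 ha hac
  -- the open set of `x ∈ K_w` with `x ∈ u · (K_wˣ)ᵖ` and `|x| = 1`
  have hvalopen : IsOpenMap (Units.val : Fˣ → F) := by
    have hrange : Set.range (Units.val : Fˣ → F) = {0}ᶜ := by
      ext y
      simp only [Set.mem_range, Set.mem_compl_iff, Set.mem_singleton_iff]
      exact ⟨fun ⟨z, hz⟩ => hz ▸ z.ne_zero, fun hy => ⟨Units.mk0 y hy, rfl⟩⟩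
    exact (⟨Units.isEmbedding_val₀, by rw [hrange]; exact isOpen_compl_singleton⟩ :
      Topology.IsOpenEmbedding (Units.val : Fˣ → F)).isOpenMap
  set C : Set Fˣ := (fun y => u⁻¹ * y) ⁻¹' ((powMonoidHom n : Fˣ →* Fˣ).range : Set Fˣ) with hCdef
  have hCopen : IsOpen C :=
    (isOpen_range_powMonoidHom_units F (Nat.cast_ne_zero.mpr (NeZero.ne n))).preimage (continuous_const_mul _)
  have hsph : IsOpen {x : F | Valued.v x = 1} := by
    rw [isOpen_iff_mem_nhds]
    intro x hx
    have hx' : Valued.v x = 1 := hx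
    have hx0 : x ≠ 0 := fun h => by rw [h, map_zero] at hx'; exact zero_ne_one hx'
    have hcont : ContinuousAt (fun c : F => x⁻¹ * c) x := (continuous_const_mul _).continuousAt
    have hN : {c : F | Valued.v (c - 1) < WithZero.exp (-((0 : ℕ) : ℤ))} ∈ nhds ((fun c : F => x⁻¹ * c) x) := by
      have h1 : (fun c : F => x⁻¹ * c) x = 1 := inv_mul_cancel₀ hx0
      rw [h1]
      exact adicCompletion_setOf_valued_sub_one_lt_mem_nhds w 0
    refine Filter.mem_of_superset (hcont.preimage_mem_nhds hN) fun y hy => ?_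
    have hy' : Valued.v (x⁻¹ * y - 1) < 1 := by
      have h := hy
      simp only [Set.mem_preimage, Set.mem_setOf_eq, Nat.cast_zero, neg_zero, WithZero.exp_zero] at h
      exact h
    have h2 : Valued.v (x⁻¹ * y) = 1 := by
      have h3 : Valued.v (x⁻¹ * y - 1) < Valued.v (1 : F) := by rw [map_one]; exact hy'
      rw [Valuation.map_eq_of_sub_lt Valued.v h3, map_one]
    change Valued.v y = 1
    rw [map_mul, map_inv₀, hx', inv_one, one_mul] at h2
    exact h2
  set O : Set F := Units.val '' C ∩ {x : F | Valued.v x = 1} with hOdef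
  have hOopen : IsOpen O := (hvalopen _ hCopen).inter hsph
  have huO : (u : F) ∈ O := by
    refine ⟨⟨u, ?_, rfl⟩, hu1⟩
    change u⁻¹ * u ∈ (((powMonoidHom n : Fˣ →* Fˣ).range : Subgroup Fˣ) : Set Fˣ)
    rw [inv_mul_cancel]; exact Subgroup.one_mem _
  -- `u ∈ 𝒪_w = closure of 𝓞_K`
  have huint : (u : F) ∈ closure ((algebraMap (𝓞 K) F).range : Set F) := by
    have h := IsDedekindDomain.HeightOneSpectrum.closureAlgebraMapIntegers_eq_integers (A := 𝓞 K) K w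
    have h' : (u : F) ∈ (SetLike.coe (w.adicCompletionIntegers K) : Set (w.adicCompletion K)) :=
      (HeightOneSpectrum.mem_adicCompletionIntegers (𝓞 K) K w).mpr hu1.le
    rw [← h] at h'
    exact h'
  obtain ⟨z, ⟨hzC, hz1⟩, ⟨a', rfl⟩⟩ := mem_closure_iff.mp huint O hOopen huO
  obtain ⟨y, hyC, hy⟩ := hzC
  obtain ⟨s, hs⟩ := hyC
  -- `a' ∈ 𝓞_K` is a `w`-unit, nonzero, congruent to `a` modulo `n`-th powers
  have hz1' : Valued.v (algebraMap (𝓞 K) F a') = 1 := hz1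
  have haw : a' ∉ w.asIdeal := by
    have h1 : Valued.v (((a' : K)) : w.adicCompletion K) = 1 := by
      rw [← algebraMap_adicCompletion_apply, ← IsScalarTower.algebraMap_apply]; exact hz1'
    rw [IsDedekindDomain.HeightOneSpectrum.valuedAdicCompletion_eq_valuation',
      show ((a' : K)) = algebraMap (𝓞 K) K a' from rfl,
      IsDedekindDomain.HeightOneSpectrum.valuation_of_algebraMap,
      IsDedekindDomain.HeightOneSpectrum.intValuation_eq_one_iff] at h1
    exact h1
  have ha'0 : ((a' : K)) ≠ 0 := fun h0 => by
    have : algebraMap (𝓞 K) F a' = 0 := by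
      rw [IsScalarTower.algebraMap_apply (𝓞 K) K F, show algebraMap (𝓞 K) K a' = (a' : K) from rfl, h0,
        map_zero]
    rw [this, map_zero] at hz1'
    exact zero_ne_one hz1'
  have hy1 : y = u * s ^ n := by rw [← powMonoidHom_apply, hs, mul_inv_cancel_left]
  have hrel : algebraMap K F a = algebraMap K F (a' : K) * ((c : F) * ((s : Fˣ) : F)⁻¹) ^ n := by
    have hya' : algebraMap K F (a' : K) = (y : F) := by
      rw [hy, IsScalarTower.algebraMap_apply (𝓞 K) K F]
    rw [hya', hy1, hac, Units.val_mul, Units.val_pow_eq_pow_val, mul_pow, inv_pow]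
    field_simp
  have hc' : (c : F) * ((s : Fˣ) : F)⁻¹ ≠ 0 := mul_ne_zero hc0 (inv_ne_zero s.ne_zero)
  rw [localization_kummer_eq_of_eq_mul_pow w (a' : K) a ha'0 ha hc' hrel]
  exact localization_kummer_mem_unramifiedSubgroup_of_not_mem w a' haw hnw ha'0

end Summit.BirchSwinnertonDyer.BirchSwinnertonDyer.Theorems.SchneiderFreeAdditiveX3.PoitouTateReduction

end
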